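import Summits.PneNP.PneNP.Theorems.SzkEntropyPeaThreeNotInPLatticeDefs
import Mathlib.Data.Nat.Size
import Mathlib.Data.Nat.Sqrt
import Mathlib.Data.Nat.Factorial.Basic
import Mathlib.Analysis.Real.Sqrt
import Mathlib.Algebra.BigOperators.Fin
import Mathlib.Algebra.Order.BigOperators.Group.List
import Mathlib.Algebra.Order.BigOperators.Group.Finset
import HarnessLib

/-!
# Route SzkEntropy, crux `PeaThreeNotInP` (stmt-PneNP-10776), line `SketchIdeator3`, socket client
# `lattice-cube-smoothing`: stub `stub_params` — the parameter arithmetic of the reduction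

On the promise (`n ≥ 2`, `d = a / den > 0`) the parameters of `SzkEntropyPeaThreeNotInPLatticeDefs`
satisfy: `K ≥ 1`; `64 n a < M` (`Nat.lt_size_self`); `(M − 1) den ≤ √n K a ≤ (M − 1) den + √n a`
(ceiling division and `Nat.sqrt`); `32 · n · n! · S₀ⁿ ≤ 2^ℓ` (`n! ≤ nⁿ`); every basis entry and every
`|t i| + a` is at most `S₀`; and every (translated) output coordinate of the samplers `p`, `q` — the
value `affineVal` of the coefficient lists `csP i`, `csQ i` — is `< 2^W`
(`≤ K S₀ 2^ℓ + n 2^m < 2^(ℓ + m + size (K S₀) + 1)`).  Elementary arithmetic. [folklore]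
-/

namespace Summit.PneNP.PneNP.Cruxes.PeaThreeNotInP.LatticeLine

set_option linter.dupNamespace false -- `Summit.PneNP.PneNP.…`: summit = sub-problem name (D-0017)

open Finset
open Summit.PneNP.PneNP.Cruxes.PeaThreeNotInP.SocketBP (affineVal)

/-! ### List bookkeeping -/

/-- An entry read with default `0` is bounded by the sum of the absolute values. [folklore] -/
theorem par_natAbs_getD_le (l : List ℤ) (k : ℕ) : (l.getD k 0).natAbs ≤ (l.map Int.natAbs).sum := by
  rcases lt_or_ge k l.length with hk | hk
  · rw [List.getD_eq_getElem _ _ hk]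
    exact List.le_sum_of_mem (List.mem_map.2 ⟨l[k], List.getElem_mem hk, rfl⟩)
  · rw [List.getD_eq_default _ _ hk]
    exact Nat.zero_le _

/-- The value of the signed affine form is at most the sum of the absolute coefficients. [folklore] -/
theorem par_affineVal_le (cs : List ℤ) (u : Fin cs.length → Bool) :
    affineVal cs u ≤ (cs.map Int.natAbs).sum := by
  unfold affineVal
  rw [← Fin.sum_univ_fun_getElem]
  refine Finset.sum_le_sum fun k _ => ?_
  simp only [Fin.getElem_fin]
  split_ifs <;> simp

/-- A `List.range` sum is a `Finset.range` sum. [folklore] -/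
theorem par_sum_range_list (f : ℕ → ℕ) (N : ℕ) : ((List.range N).map f).sum = ∑ k ∈ range N, f k := by
  induction N with
  | zero => simp
  | succ N ih => rw [List.sum_range_succ, Finset.sum_range_succ, ih]

/-- Block reindexing `k = i' L + s` of a sum over `range (N L)`. [folklore] -/
theorem par_sum_range_mul (f : ℕ → ℕ) (N L : ℕ) :
    ∑ k ∈ range (N * L), f k = ∑ i' ∈ range N, ∑ s ∈ range L, f (i' * L + s) := by
  induction N with
  | zero => simp
  | succ N ih => rw [Nat.succ_mul, Finset.sum_range_add, Finset.sum_range_succ, ih]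

/-- `∑_{s < L} 2^s + 1 = 2^L`. [folklore] -/
theorem par_geom_two (L : ℕ) : ∑ s ∈ range L, 2 ^ s + 1 = 2 ^ L := by
  induction L with
  | zero => simp
  | succ L ih => rw [Finset.sum_range_succ, pow_succ]; omega

/-- Ceiling division: `X ≤ q ⌈X / q⌉ ≤ X + q − 1`. [folklore] -/
theorem par_ceilDiv_bounds (X q : ℕ) (hq : 0 < q) :
    X ≤ q * ((X + q - 1) / q) ∧ q * ((X + q - 1) / q) ≤ X + q - 1 := by
  refine ⟨?_, Nat.mul_div_le (X + q - 1) q⟩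
  have h1 := Nat.div_add_mod (X + q - 1) q
  have h2 := Nat.mod_lt (X + q - 1) hq
  omega

/-! ### Entries against `S₀` -/

/-- The sum of the absolute values of a list as a `Finset.range` sum over positions. [folklore] -/
theorem par_sum_map_natAbs (l : List ℤ) :
    (l.map Int.natAbs).sum = ∑ j ∈ range l.length, (l.getD j 0).natAbs := by
  rw [Finset.sum_range, ← Fin.sum_univ_fun_getElem]
  refine Finset.sum_congr rfl fun j _ => ?_
  rw [List.getD_eq_getElem _ _ j.2]

/-- A column of the basis is dominated by the whole entry list: `∑_{i' < n} |B i' i| ≤ Σ |B|`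
(the positions `i' n + i` are distinct). [folklore] -/
theorem par_sum_entry_le (c : CVPTup) (hn : 0 < c.n) (i : ℕ) :
    ∑ i' ∈ range c.n, (c.entry i' i).natAbs ≤ (c.flat.map Int.natAbs).sum := by
  rw [par_sum_map_natAbs,
    ← Finset.sum_filter_of_ne (p := fun i' => i' * c.n + i < c.flat.length) (fun i' _ h => ?_)]
  · calc ∑ i' ∈ (range c.n).filter (fun i' => i' * c.n + i < c.flat.length), (c.entry i' i).natAbs
        = ∑ j ∈ ((range c.n).filter (fun i' => i' * c.n + i < c.flat.length)).image
            (fun i' => i' * c.n + i), (c.flat.getD j 0).natAbs := by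
          rw [Finset.sum_image]
          · rfl
          · intro x _ y _ hxy
            exact Nat.eq_of_mul_eq_mul_right hn (by simpa using hxy)
      _ ≤ ∑ j ∈ range c.flat.length, (c.flat.getD j 0).natAbs := by
          apply Finset.sum_le_sum_of_subset
          intro j hj
          simp only [Finset.mem_image, Finset.mem_filter, Finset.mem_range] at hj
          obtain ⟨i', ⟨_, hi'⟩, rfl⟩ := hj
          exact Finset.mem_range.2 hi'
  · by_contra hlt
    exact h (by rw [CVPTup.entry, List.getD_eq_default _ _ (not_lt.1 hlt)]; rfl)

/-! ### The coefficient lists against `2^W` -/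

/-- The absolute coefficients of the `z`- and `e`-bits of one output coordinate sum to at most
`K · Σ|B| · 2^ℓ + n · 2^m`. [folklore] -/
theorem par_sum_coefZE_le (c : CVPTup) (hn : 0 < c.n) (i : ℕ) :
    ∑ k ∈ range c.nzE, (c.coefZE i k).natAbs ≤
      c.K * (c.flat.map Int.natAbs).sum * 2 ^ c.ℓ + c.n * 2 ^ c.m := by
  unfold CVPTup.nzE
  rw [Finset.sum_range_add]
  apply add_le_add
  · rw [par_sum_range_mul]
    calc ∑ i' ∈ range c.n, ∑ s ∈ range c.ℓ, (c.coefZE i (i' * c.ℓ + s)).natAbs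
        = ∑ i' ∈ range c.n, ∑ s ∈ range c.ℓ, c.K * (c.entry i' i).natAbs * 2 ^ s := by
          refine Finset.sum_congr rfl fun i' hi' => Finset.sum_congr rfl fun s hs => ?_
          have hs' := Finset.mem_range.1 hs
          have hi'' := Finset.mem_range.1 hi'
          have hℓ : 0 < c.ℓ := by omega
          have hlt : i' * c.ℓ + s < c.n * c.ℓ := by
            have : (i' + 1) * c.ℓ ≤ c.n * c.ℓ := Nat.mul_le_mul_right _ hi''
            rw [Nat.succ_mul] at this
            omega
          have hdiv : (i' * c.ℓ + s) / c.ℓ = i' := by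
            rw [Nat.add_comm, Nat.add_mul_div_right _ _ hℓ, Nat.div_eq_of_lt hs', Nat.zero_add]
          have hmod : (i' * c.ℓ + s) % c.ℓ = s := by
            rw [Nat.add_comm, Nat.add_mul_mod_self_right, Nat.mod_eq_of_lt hs']
          simp only [CVPTup.coefZE, if_pos hlt, hdiv, hmod, Int.natAbs_mul, Int.natAbs_pow,
            Int.natAbs_natCast]
          rfl
      _ ≤ ∑ i' ∈ range c.n, c.K * (c.entry i' i).natAbs * 2 ^ c.ℓ := by
          have hg := par_geom_two c.ℓ
          refine Finset.sum_le_sum fun i' _ => ?_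
          rw [← Finset.mul_sum]
          exact Nat.mul_le_mul_left _ (by omega)
      _ = c.K * (∑ i' ∈ range c.n, (c.entry i' i).natAbs) * 2 ^ c.ℓ := by
          rw [Finset.mul_sum, Finset.sum_mul]
      _ ≤ c.K * (c.flat.map Int.natAbs).sum * 2 ^ c.ℓ :=
          Nat.mul_le_mul_right _ (Nat.mul_le_mul_left _ (par_sum_entry_le c hn i))
  · rw [par_sum_range_mul]
    calc ∑ i'' ∈ range c.n, ∑ s ∈ range c.m, (c.coefZE i (c.n * c.ℓ + (i'' * c.m + s))).natAbs
        ≤ ∑ i'' ∈ range c.n, ∑ s ∈ range c.m, 2 ^ s := by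
          refine Finset.sum_le_sum fun i'' _ => Finset.sum_le_sum fun s hs => ?_
          have hs' := Finset.mem_range.1 hs
          have hmod : (i'' * c.m + s) % c.m = s := by
            rw [Nat.add_comm, Nat.add_mul_mod_self_right, Nat.mod_eq_of_lt hs']
          simp only [CVPTup.coefZE, if_neg (Nat.not_lt.2 (Nat.le_add_right _ _)),
            Nat.add_sub_cancel_left, hmod]
          split_ifs <;> simp [Int.natAbs_pow]
      _ = c.n * ∑ s ∈ range c.m, 2 ^ s := by
          rw [Finset.sum_const, Finset.card_range, smul_eq_mul]
      _ ≤ c.n * 2 ^ c.m := by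
          have hg := par_geom_two c.m
          exact Nat.mul_le_mul_left _ (by omega)

/-- The sum of the absolute coefficients of `csP i`. [folklore] -/
theorem par_sum_csP (c : CVPTup) (i : ℕ) :
    ((c.csP i).map Int.natAbs).sum = c.K * (c.tgt i).natAbs + ∑ k ∈ range c.nzE, (c.coefZE i k).natAbs := by
  simp only [CVPTup.csP, List.map_cons, List.sum_cons, List.map_map, Int.natAbs_mul,
    Int.natAbs_natCast, Function.comp_def]
  rw [par_sum_range_list]

/-- The sum of the absolute coefficients of `csQ i`. [folklore] -/
theorem par_sum_csQ (c : CVPTup) (i : ℕ) :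
    ((c.csQ i).map Int.natAbs).sum = ∑ k ∈ range c.nzE, (c.coefZE i k).natAbs := by
  simp only [CVPTup.csQ, List.map_cons, List.sum_cons, List.map_map, Int.natAbs_zero, zero_add,
    Function.comp_def]
  rw [par_sum_range_list]

/-- **Every translated output coordinate is `< 2^W`**:
`K |t i| + ∑_k |coefZE i k| ≤ K S₀ 2^ℓ + n 2^m < 2^(ℓ + m + size (K S₀) + 1)`. [folklore] -/
theorem par_head_sum_lt (c : CVPTup) (hn : 2 ≤ c.n) (i : ℕ) :
    c.K * (c.tgt i).natAbs + ∑ k ∈ range c.nzE, (c.coefZE i k).natAbs < 2 ^ c.W := by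
  have hF := par_natAbs_getD_le c.tl i
  have hS : (c.flat.map Int.natAbs).sum + (c.tl.map Int.natAbs).sum ≤ c.S₀ := by
    unfold CVPTup.S₀; omega
  have hR : c.K * c.S₀ < 2 ^ Nat.size (c.K * c.S₀) := Nat.lt_size_self _
  have hsz : 1 ≤ Nat.size (c.n * c.S₀ + 1) := Nat.size_pos.2 (Nat.succ_pos _)
  have hnℓ : c.n ≤ c.ℓ := by
    have := Nat.mul_le_mul_left (c.n + 1) hsz
    unfold CVPTup.ℓ; omega
  have hnP : c.n ≤ 2 ^ c.ℓ := Nat.lt_two_pow_self.le.trans (Nat.pow_le_pow_right (by norm_num) hnℓ)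
  have hPpos : 0 < 2 ^ c.ℓ := Nat.two_pow_pos _
  have hQpos : 0 < 2 ^ c.m := Nat.two_pow_pos _
  have hRpos : 0 < 2 ^ Nat.size (c.K * c.S₀) := Nat.two_pow_pos _
  have hW : 2 ^ c.W = 2 ^ c.ℓ * 2 ^ c.m * 2 ^ Nat.size (c.K * c.S₀) * 2 := by
    show 2 ^ (c.ℓ + c.m + Nat.size (c.K * c.S₀) + 1) = _
    rw [pow_succ, pow_add, pow_add]
  have hKT : c.K * (c.tgt i).natAbs ≤ c.K * (c.tl.map Int.natAbs).sum * 2 ^ c.ℓ :=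
    (Nat.mul_le_mul_left _ hF).trans (Nat.le_mul_of_pos_right _ hPpos)
  have hZE := par_sum_coefZE_le c (by omega) i
  calc c.K * (c.tgt i).natAbs + ∑ k ∈ range c.nzE, (c.coefZE i k).natAbs
      ≤ c.K * (c.tl.map Int.natAbs).sum * 2 ^ c.ℓ +
          (c.K * (c.flat.map Int.natAbs).sum * 2 ^ c.ℓ + 2 ^ c.ℓ * 2 ^ c.m) := by
        refine add_le_add hKT (hZE.trans (Nat.add_le_add_left ?_ _))
        exact Nat.mul_le_mul_right _ hnP
    _ = c.K * ((c.flat.map Int.natAbs).sum + (c.tl.map Int.natAbs).sum) * 2 ^ c.ℓ +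
          2 ^ c.ℓ * 2 ^ c.m := by ring
    _ ≤ c.K * c.S₀ * 2 ^ c.ℓ + 2 ^ c.ℓ * 2 ^ c.m :=
        Nat.add_le_add_right (Nat.mul_le_mul_right _ (Nat.mul_le_mul_left _ hS)) _
    _ < 2 ^ Nat.size (c.K * c.S₀) * 2 ^ c.ℓ + 2 ^ c.ℓ * 2 ^ c.m :=
        Nat.add_lt_add_right (Nat.mul_lt_mul_of_pos_right hR hPpos) _
    _ ≤ 2 ^ Nat.size (c.K * c.S₀) * 2 ^ c.ℓ * 2 ^ c.m + 2 ^ c.ℓ * 2 ^ c.m * 2 ^ Nat.size (c.K * c.S₀) :=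
        add_le_add (Nat.le_mul_of_pos_right _ hQpos) (Nat.le_mul_of_pos_right _ hRpos)
    _ = 2 ^ c.W := by rw [hW]; ring

/-! ### The scaling factor `K` -/

/-- The defining inequalities of `K = Nat.sqrt (c − 1) + 1`, `c = ⌈(M−1)² den² / (n a²)⌉`, in `ℕ`:
`(M−1)² den² ≤ n a² K²` and `n a² (K−1)² ≤ (M−1)² den²`. [folklore] -/
theorem par_K_sq_bounds (c : CVPTup) (hq : 0 < c.n * c.a ^ 2) :
    (c.M - 1) ^ 2 * c.den ^ 2 ≤ c.n * c.a ^ 2 * c.K ^ 2 ∧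
      c.n * c.a ^ 2 * (c.K - 1) ^ 2 ≤ (c.M - 1) ^ 2 * c.den ^ 2 := by
  obtain ⟨h1, h2⟩ := par_ceilDiv_bounds ((c.M - 1) ^ 2 * c.den ^ 2) (c.n * c.a ^ 2) hq
  have hcK : c.cK = ((c.M - 1) ^ 2 * c.den ^ 2 + c.n * c.a ^ 2 - 1) / (c.n * c.a ^ 2) := rfl
  rw [← hcK] at h1 h2
  have hK : c.K = Nat.sqrt (c.cK - 1) + 1 := rfl
  have hup : c.cK - 1 < c.K ^ 2 := hK ▸ Nat.lt_succ_sqrt' (c.cK - 1)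
  have hlow : (c.K - 1) ^ 2 ≤ c.cK - 1 := by rw [hK, Nat.add_sub_cancel]; exact Nat.sqrt_le' _
  constructor
  · have : c.n * c.a ^ 2 * c.cK ≤ c.n * c.a ^ 2 * c.K ^ 2 := Nat.mul_le_mul_left _ (by omega)
    omega
  · have e1 : c.n * c.a ^ 2 * (c.K - 1) ^ 2 ≤ c.n * c.a ^ 2 * (c.cK - 1) := Nat.mul_le_mul_left _ hlow
    have e2 : c.n * c.a ^ 2 * (c.cK - 1) = c.n * c.a ^ 2 * c.cK - c.n * c.a ^ 2 := Nat.mul_sub_one _ _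
    omega

/-! ### The stub -/

/-- **(W6) Parameter arithmetic** on the promise (`n ≥ 2`, `d = a/den > 0`): `K ≥ 1`; `64 n a < M`;
`(M−1) den ≤ √n K a ≤ (M−1) den + √n a`; `32 · n · n! · S₀ⁿ ≤ 2^ℓ`; entries against `S₀`; every
translated output coordinate `< 2^W`. [folklore] -/
theorem stub_params (c : CVPTup) (hn : 2 ≤ c.n) (hnum : 0 < c.num) (hden : 0 < c.den) : 1 ≤ c.K ∧ 64 * c.n * c.a < c.M ∧ ((c.M : ℝ) - 1) * c.den ≤ Real.sqrt c.n * c.K * c.a ∧ Real.sqrt c.n * c.K * c.a ≤ ((c.M : ℝ) - 1) * c.den + Real.sqrt c.n * c.a ∧ 32 * c.n * (c.n.factorial * c.S₀ ^ c.n) ≤ 2 ^ c.ℓ ∧ (∀ i' i : ℕ, (c.entry i' i).natAbs ≤ c.S₀) ∧ (∀ i : ℕ, (c.tgt i).natAbs + c.a ≤ c.S₀) ∧ (∀ (i : ℕ) (u : Fin (c.csP i).length → Bool), i < c.n → affineVal (c.csP i) u < 2 ^ c.W) ∧ (∀ (i : ℕ) (u : Fin (c.csQ i).length → Bool), i < c.n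 → affineVal (c.csQ i) u < 2 ^ c.W) := by
  have _hden := hden -- part of the registered signature; the arithmetic below does not need it
  have hK1 : 1 ≤ c.K := Nat.le_add_left 1 _
  have ha : 0 < c.a := by show 0 < c.num.toNat; omega
  have hq : 0 < c.n * c.a ^ 2 := Nat.mul_pos (by omega) (Nat.pow_pos ha)
  have hM1 : 1 ≤ c.M := Nat.one_le_two_pow
  obtain ⟨hupN, hlowN⟩ := par_K_sq_bounds c hq
  -- the real square roots
  have hcast : ((c.M - 1 : ℕ) : ℝ) = (c.M : ℝ) - 1 := by rw [Nat.cast_sub hM1, Nat.cast_one]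
  have hK1R : ((c.K - 1 : ℕ) : ℝ) = (c.K : ℝ) - 1 := by rw [Nat.cast_sub hK1, Nat.cast_one]
  have hsq : Real.sqrt (c.n : ℝ) ^ 2 = c.n := Real.sq_sqrt (Nat.cast_nonneg _)
  have hA : 0 ≤ ((c.M : ℝ) - 1) * c.den :=
    mul_nonneg (by rw [← hcast]; exact Nat.cast_nonneg _) (Nat.cast_nonneg _)
  have hB : 0 ≤ Real.sqrt c.n * c.K * c.a := by positivity
  have hC : 0 ≤ Real.sqrt c.n * c.a * ((c.K : ℝ) - 1) := by rw [← hK1R]; positivity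
  have hupR : ((c.M : ℝ) - 1) ^ 2 * (c.den : ℝ) ^ 2 ≤ (c.n : ℝ) * (c.a : ℝ) ^ 2 * (c.K : ℝ) ^ 2 := by
    rw [← hcast]; exact_mod_cast hupN
  have hlowR : (c.n : ℝ) * (c.a : ℝ) ^ 2 * ((c.K : ℝ) - 1) ^ 2 ≤ ((c.M : ℝ) - 1) ^ 2 * (c.den : ℝ) ^ 2 := by
    rw [← hcast, ← hK1R]; exact_mod_cast hlowN
  have c3 : ((c.M : ℝ) - 1) * c.den ≤ Real.sqrt c.n * c.K * c.a := by
    rw [← pow_le_pow_iff_left₀ hA hB two_ne_zero]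
    calc (((c.M : ℝ) - 1) * c.den) ^ 2 = ((c.M : ℝ) - 1) ^ 2 * (c.den : ℝ) ^ 2 := by ring
      _ ≤ (c.n : ℝ) * (c.a : ℝ) ^ 2 * (c.K : ℝ) ^ 2 := hupR
      _ = (Real.sqrt c.n * c.K * c.a) ^ 2 := by rw [mul_pow, mul_pow, hsq]; ring
  have c4' : Real.sqrt c.n * c.a * ((c.K : ℝ) - 1) ≤ ((c.M : ℝ) - 1) * c.den := by
    rw [← pow_le_pow_iff_left₀ hC hA two_ne_zero]
    calc (Real.sqrt c.n * c.a * ((c.K : ℝ) - 1)) ^ 2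
        = (c.n : ℝ) * (c.a : ℝ) ^ 2 * ((c.K : ℝ) - 1) ^ 2 := by rw [mul_pow, mul_pow, hsq]
      _ ≤ ((c.M : ℝ) - 1) ^ 2 * (c.den : ℝ) ^ 2 := hlowR
      _ = (((c.M : ℝ) - 1) * c.den) ^ 2 := by ring
  have c4 : Real.sqrt c.n * c.K * c.a ≤ ((c.M : ℝ) - 1) * c.den + Real.sqrt c.n * c.a := by
    have e : Real.sqrt c.n * c.K * c.a = Real.sqrt c.n * c.a * ((c.K : ℝ) - 1) + Real.sqrt c.n * c.a := by
      ring
    rw [e]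
    exact add_le_add c4' le_rfl
  -- the box parameter `ℓ`
  have hS0 : 1 ≤ c.S₀ := by unfold CVPTup.S₀; omega
  have c5 : 32 * c.n * (c.n.factorial * c.S₀ ^ c.n) ≤ 2 ^ c.ℓ := by
    show 32 * c.n * (c.n.factorial * c.S₀ ^ c.n) ≤ 2 ^ (5 + (c.n + 1) * Nat.size (c.n * c.S₀ + 1))
    rw [pow_add, pow_mul', show (2 : ℕ) ^ 5 = 32 from rfl, mul_assoc]
    apply Nat.mul_le_mul_left
    have hT : c.n * c.S₀ + 1 ≤ 2 ^ Nat.size (c.n * c.S₀ + 1) := (Nat.lt_size_self _).le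
    have hnS : c.n ≤ c.n * c.S₀ + 1 := (Nat.le_mul_of_pos_right _ hS0).trans (Nat.le_succ _)
    calc c.n * (c.n.factorial * c.S₀ ^ c.n) ≤ c.n * (c.n ^ c.n * c.S₀ ^ c.n) :=
          Nat.mul_le_mul_left _ (Nat.mul_le_mul_right _ (Nat.factorial_le_pow _))
      _ = c.n * (c.n * c.S₀) ^ c.n := by rw [Nat.mul_pow]
      _ ≤ (c.n * c.S₀ + 1) * (c.n * c.S₀ + 1) ^ c.n :=
          Nat.mul_le_mul hnS (Nat.pow_le_pow_left (Nat.le_succ _) _)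
      _ = (c.n * c.S₀ + 1) ^ (c.n + 1) := by rw [pow_succ, Nat.mul_comm]
      _ ≤ (2 ^ Nat.size (c.n * c.S₀ + 1)) ^ (c.n + 1) := Nat.pow_le_pow_left hT _
  refine ⟨hK1, Nat.lt_size_self _, c3, c4, c5, fun i' i => ?_, fun i => ?_, fun i u _ => ?_, fun i u _ => ?_⟩
  · exact (par_natAbs_getD_le c.flat _).trans (by unfold CVPTup.S₀; omega)
  · have := par_natAbs_getD_le c.tl i
    show (c.tl.getD i 0).natAbs + c.a ≤ c.S₀
    unfold CVPTup.S₀; omega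
  · refine (par_affineVal_le _ u).trans_lt ?_
    rw [par_sum_csP]
    exact par_head_sum_lt c hn i
  · refine (par_affineVal_le _ u).trans_lt ?_
    rw [par_sum_csQ]
    exact (Nat.le_add_left _ _).trans_lt (par_head_sum_lt c hn i)

end Summit.PneNP.PneNP.Cruxes.PeaThreeNotInP.LatticeLine
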